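import Literature.RingTheory.MvPolynomial.HilbertPolynomialDegree
import HarnessLib

/-!
# Equidimensional intersections of homogeneous primes: dimension and additivity of the degree

Topic: `Literature/RingTheory/MvPolynomial`. Preliminaries for the Bézout-type counting of
top-dimensional components (`ConeBezoutCount.lean`; Nesterenko–Philippon (eds.), LNM 1752, Ch. 11
§2.2 (ii) and Prop. 2.2): for a finite set `𝓠` of prime ideals of `S = K[X_0, …, X_{m-1}]` all of
the same dimension `dim S/𝔮 = n`,

* `ringKrullDim_quotient_finset_inf` — `dim S/⋂𝓠 = n`;
* `eq_of_le_of_ringKrullDim_quotient_eq` — comparable primes of the same finite dimension are equal;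
* `ringKrullDim_quotient_sup_lt_of_not_le` — `dim S/(𝔭 + I) < dim S/𝔭` for a prime `𝔭 ⊉ I`;
* `isHomogeneous_finset_inf`, `mem_finset_inf_of_mul_mem` — `⋂𝓠` is homogeneous when the `𝔮`
  are, and an element outside every `𝔮` is a non-zero-divisor modulo `⋂𝓠`;
* `not_idealDegree_le_of_not_le` — if `𝔞` is generated by forms of degree `≤ D` and `𝔞 ⊄ 𝔮` for a
  prime `𝔮` missing a variable, then already `𝔞_D ⊄ 𝔮`;
* **`card_mul_inv_factorial_le_coeff`** — additivity of the degree over equidimensional components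
  in inequality form (LNM 1752 Ch. 11 §2.2 (ii) "`deg I = Σ ℓ_i deg 𝔭_i`", here: for distinct
  homogeneous primes `𝔮 ∈ 𝓠` of dimension `a + 1`, the Hilbert polynomial `P` of `⋂𝓠` has
  `coeff_a P ≥ |𝓠| / a!`, each prime contributing `lc P_𝔮 ≥ 1/a!` by
  `natDegree_hilbertPolynomial`).

## References

* Yu. V. Nesterenko, P. Philippon (eds.), *Introduction to Algebraic Independence Theory*,
  LNM 1752 (2001), Ch. 11 (D. Roy), §2.2 (ii). [NesterenkoPhilippon2001]
* R. Hartshorne, *Algebraic Geometry*, GTM 52 (1977), Ch. I, Prop. 7.6 (b). [Hartshorne1977]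
-/

noncomputable section

open Module Polynomial

attribute [local instance] MvPolynomial.gradedAlgebra

namespace Literature.RingTheory.MvPolynomial

variable {K : Type*} [Field K] {m : ℕ}

local notation "hilb(" I ", " t ")" =>
  (Module.finrank K (MvPolynomial.homogeneousSubmodule (Fin m) K t) -
    Module.finrank K (idealDegree I t))

/-! ## Krull dimension of equidimensional intersections -/

/-- **`dim R/⋂𝓠 = n` for a non-empty finite family of ideals of dimension `n`**: `≥` through
any member, `≤` because a chain of primes above `⋂𝓠` lies above some member (a prime containing a
finite intersection contains a member). [folklore] -/
theorem ringKrullDim_quotient_finset_inf {R : Type*} [CommRing R] {𝓠 : Finset (Ideal R)}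
    (hne : 𝓠.Nonempty) {n : ℕ} (hdim : ∀ 𝔮 ∈ 𝓠, ringKrullDim (R ⧸ 𝔮) = n) :
    ringKrullDim (R ⧸ 𝓠.inf id) = n := by
  obtain ⟨𝔮₀, h𝔮₀⟩ := hne
  refine le_antisymm ?_ ?_
  · apply ENat.WithBot.lt_add_one_iff.mp
    rw [ringKrullDim_quotient, ← Nat.cast_add_one, Order.krullDim_lt_coe_iff]
    intro l
    have hJ : 𝓠.inf id ≤ (l.head).1.asIdeal := l.head.2
    obtain ⟨𝔮, h𝔮, h𝔮le⟩ := (Ideal.IsPrime.inf_le' (l.head).1.2).mp hJ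
    let l' : LTSeries (PrimeSpectrum.zeroLocus (R := R) ((𝔮 : Ideal R) : Set R)) :=
      ⟨l.length, fun i => ⟨(l i).1, fun y hy => (l.head_le i) (h𝔮le hy)⟩, fun i => l.step i⟩
    have := Order.LTSeries.length_le_krullDim l'
    rw [← ringKrullDim_quotient, hdim 𝔮 h𝔮] at this
    have : l.length ≤ n := by exact_mod_cast this
    omega
  · rw [← hdim 𝔮₀ h𝔮₀]
    exact ringKrullDim_le_of_surjective (Ideal.Quotient.factor (Finset.inf_le h𝔮₀))
      (Ideal.Quotient.factor_surjective _)

/-- **`dim R/(𝔭 + I) < dim R/𝔭` for a prime `𝔭` not containing `I`** (an element of `I ∖ 𝔭` is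
outside the unique minimal prime `𝔭` of `𝔭`). [folklore] -/
theorem ringKrullDim_quotient_sup_lt_of_not_le {R : Type*} [CommRing R] {𝔭 I : Ideal R}
    [h𝔭 : 𝔭.IsPrime] {n : ℕ} (hdim : ringKrullDim (R ⧸ 𝔭) = n) (hI : ¬ I ≤ 𝔭) :
    ringKrullDim (R ⧸ (𝔭 ⊔ I)) < n := by
  obtain ⟨x, hxI, hx𝔭⟩ := Set.not_subset.mp hI
  have hlt : ringKrullDim (R ⧸ (𝔭 ⊔ Ideal.span {x})) < n := by
    refine ringKrullDim_quotient_sup_span_lt hdim.le fun 𝔮 h𝔮 hx𝔮 => ?_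
    rw [Ideal.minimalPrimes_eq_subsingleton_self, Set.mem_singleton_iff] at h𝔮
    subst h𝔮
    exact absurd hx𝔮 hx𝔭
  refine lt_of_le_of_lt ?_ hlt
  have hle : 𝔭 ⊔ Ideal.span {x} ≤ 𝔭 ⊔ I :=
    sup_le_sup_left ((Ideal.span_singleton_le_iff_mem _).mpr hxI) _
  exact ringKrullDim_le_of_surjective (Ideal.Quotient.factor hle) (Ideal.Quotient.factor_surjective _)

/-- **Comparable primes of the same finite dimension are equal.** [folklore] -/
theorem eq_of_le_of_ringKrullDim_quotient_eq {R : Type*} [CommRing R] {𝔮 𝔓 : Ideal R}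
    [𝔮.IsPrime] [𝔓.IsPrime] (hle : 𝔮 ≤ 𝔓) {n : ℕ} (h𝔮 : ringKrullDim (R ⧸ 𝔮) = n)
    (h𝔓 : ringKrullDim (R ⧸ 𝔓) = n) : 𝔮 = 𝔓 := by
  by_contra hne
  have hnle : ¬ 𝔓 ≤ 𝔮 := fun h => hne (le_antisymm hle h)
  have hlt := ringKrullDim_quotient_sup_lt_of_not_le h𝔮 hnle
  rw [sup_eq_right.mpr hle, h𝔓] at hlt
  exact lt_irrefl _ hlt

/-! ## Finite intersections of homogeneous primes -/

/-- A finite intersection of homogeneous ideals is homogeneous. [folklore] -/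
theorem isHomogeneous_finset_inf {𝓠 : Finset (Ideal (MvPolynomial (Fin m) K))}
    (h : ∀ 𝔮 ∈ 𝓠, 𝔮.IsHomogeneous (MvPolynomial.homogeneousSubmodule (Fin m) K)) :
    (𝓠.inf id).IsHomogeneous (MvPolynomial.homogeneousSubmodule (Fin m) K) := by
  classical
  induction 𝓠 using Finset.induction_on with
  | empty => simpa using Ideal.IsHomogeneous.top _
  | insert 𝔮 𝓠 h𝔮 ih =>
    rw [Finset.inf_insert]
    exact (h 𝔮 (Finset.mem_insert_self _ _)).inf (ih fun 𝔮' h𝔮' => h 𝔮' (Finset.mem_insert_of_mem h𝔮'))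

/-- An element outside each prime `𝔮 ∈ 𝓠` is a non-zero-divisor modulo `⋂𝓠`. [folklore] -/
theorem mem_finset_inf_of_mul_mem {R : Type*} [CommRing R] {𝓠 : Finset (Ideal R)}
    (hprime : ∀ 𝔮 ∈ 𝓠, 𝔮.IsPrime) {Q : R} (hQ : ∀ 𝔮 ∈ 𝓠, Q ∉ 𝔮) (f : R)
    (hf : Q * f ∈ 𝓠.inf id) : f ∈ 𝓠.inf id := by
  classical
  rw [Submodule.mem_finsetInf] at hf ⊢
  intro 𝔮 h𝔮
  exact ((hprime 𝔮 h𝔮).mem_or_mem (hf 𝔮 h𝔮)).resolve_left (hQ 𝔮 h𝔮)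

/-- **Degree-`D` avoidance**: if `𝔞` is generated by forms of degree `≤ D` and `𝔞 ⊄ 𝔮` for a
prime `𝔮` missing the variable `X_j`, then the degree-`D` piece `𝔞_D` is not contained in `𝔮`
(multiply a generator of degree `k` by `X_j^{D-k}`). [folklore] -/
theorem not_idealDegree_le_of_not_le {𝔞 𝔮 : Ideal (MvPolynomial (Fin m) K)} [𝔮.IsPrime]
    {D : ℕ} {G : Set (MvPolynomial (Fin m) K)} (hG : 𝔞 = Ideal.span G)
    (hGdeg : ∀ g ∈ G, ∃ k, k ≤ D ∧ g.IsHomogeneous k) {j : Fin m}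
    (hj : (MvPolynomial.X j : MvPolynomial (Fin m) K) ∉ 𝔮) (hnot : ¬ 𝔞 ≤ 𝔮) :
    ¬ idealDegree 𝔞 D ≤ 𝔮.restrictScalars K := by
  intro hle
  apply hnot
  rw [hG, Ideal.span_le]
  intro g hg
  obtain ⟨k, hk, hgk⟩ := hGdeg g hg
  have hmem : MvPolynomial.X j ^ (D - k) * g ∈ idealDegree 𝔞 D := by
    refine ⟨Ideal.mul_mem_left _ _ (hG ▸ Ideal.subset_span hg), ?_⟩
    have := (MvPolynomial.isHomogeneous_X_pow j (D - k)).mul hgk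
    rwa [Nat.sub_add_cancel hk] at this
  have h𝔮 : MvPolynomial.X j ^ (D - k) * g ∈ 𝔮 := hle hmem
  rcases (‹𝔮.IsPrime›).mem_or_mem h𝔮 with h | h
  · exact absurd ((‹𝔮.IsPrime›).mem_of_pow_mem _ h) hj
  · exact h

/-! ## Additivity of the degree over equidimensional components -/

/-- **`coeff_a P_{⋂𝓠} ≥ |𝓠| / a!`** for a non-empty finite set `𝓠` of homogeneous primes of
dimension `a + 1` and any polynomial `P` agreeing with `H(⋂𝓠; ·)` for large `t`
(LNM 1752 Ch. 11 §2.2 (ii), inequality form; each prime contributes `≥ 1/a!` by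
`natDegree_hilbertPolynomial`, and the contributions add up by `coeff_hilbertPolynomial_inf`
because `dim S/(𝔮 + ⋂𝓠') ≤ a` for `𝔮 ∉ 𝓠'`). [cite: NesterenkoPhilippon2001, Ch. 11 §2.2 (ii)] -/
theorem card_mul_inv_factorial_le_coeff [Infinite K] {a : ℕ} :
    ∀ (𝓠 : Finset (Ideal (MvPolynomial (Fin m) K))), 𝓠.Nonempty →
      (∀ 𝔮 ∈ 𝓠, 𝔮.IsPrime ∧ 𝔮.IsHomogeneous (MvPolynomial.homogeneousSubmodule (Fin m) K) ∧
        ringKrullDim (MvPolynomial (Fin m) K ⧸ 𝔮) = (a + 1 : ℕ)) →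
      ∀ (P : ℚ[X]) (t₀ : ℕ), (∀ t, t₀ ≤ t → ((hilb(𝓠.inf id, t) : ℕ) : ℚ) = P.eval (t : ℚ)) →
        (𝓠.card : ℚ) * (((a.factorial : ℕ) : ℚ)⁻¹) ≤ P.coeff a := by
  classical
  intro 𝓠
  induction 𝓠 using Finset.induction_on with
  | empty => intro h; exact absurd h Finset.not_nonempty_empty
  | insert 𝔮 𝓠 h𝔮𝓠 ih =>
    intro _ h𝓠 P t₀ hP
    obtain ⟨h𝔮prime, h𝔮hom, h𝔮dim⟩ := h𝓠 𝔮 (Finset.mem_insert_self _ _)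
    haveI := h𝔮prime
    have h𝓠' : ∀ 𝔮' ∈ 𝓠, 𝔮'.IsPrime ∧
        𝔮'.IsHomogeneous (MvPolynomial.homogeneousSubmodule (Fin m) K) ∧
        ringKrullDim (MvPolynomial (Fin m) K ⧸ 𝔮') = (a + 1 : ℕ) :=
      fun 𝔮' h𝔮' => h𝓠 𝔮' (Finset.mem_insert_of_mem h𝔮')
    -- the Hilbert polynomial of `𝔮` alone
    obtain ⟨P𝔮, t₁, hP𝔮⟩ := exists_hilbertPolynomial 𝔮 h𝔮hom
    have hdeg𝔮 := natDegree_hilbertPolynomial h𝔮hom h𝔮dim hP𝔮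
    have hlc𝔮 : P𝔮.coeff a = P𝔮.leadingCoeff := by rw [Polynomial.leadingCoeff, hdeg𝔮.1]
    rcases 𝓠.eq_empty_or_nonempty with h𝓠e | h𝓠ne
    · subst h𝓠e
      simp only [Finset.insert_empty, Finset.card_singleton, Nat.cast_one, one_mul]
      have e : (insert 𝔮 (∅ : Finset (Ideal (MvPolynomial (Fin m) K)))).inf id = 𝔮 := by
        rw [Finset.inf_insert, Finset.inf_empty]; exact inf_top_eq 𝔮
      rw [e] at hP
      -- `P = P𝔮` on large `t`, so the coefficients agree
      have hPP : P = P𝔮 := by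
        apply Polynomial.eq_of_infinite_eval_eq
        apply Set.infinite_of_forall_exists_gt
        intro q
        obtain ⟨t, ht⟩ := exists_nat_gt q
        refine ⟨((max t (max t₀ t₁) : ℕ) : ℚ), ?_, ht.trans_le (by exact_mod_cast le_max_left _ _)⟩
        change P.eval _ = P𝔮.eval _
        rw [← hP _ (le_trans (le_max_left _ _) (le_max_right _ _)),
          ← hP𝔮 _ (le_trans (le_max_right _ _) (le_max_right _ _))]
      rw [hPP, hlc𝔮]
      exact hdeg𝔮.2
    · -- `inf (insert 𝔮 𝓠) = 𝔮 ⊓ inf 𝓠`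
      obtain ⟨Pinf, t₂, hPinf⟩ := exists_hilbertPolynomial (𝓠.inf id) (isHomogeneous_finset_inf
        fun 𝔮' h𝔮' => (h𝓠' 𝔮' h𝔮').2.1)
      have hih := ih h𝓠ne h𝓠' Pinf t₂ hPinf
      obtain ⟨Psup, t₃, hPsup⟩ := exists_hilbertPolynomial (𝔮 ⊔ 𝓠.inf id)
        (h𝔮hom.sup (isHomogeneous_finset_inf fun 𝔮' h𝔮' => (h𝓠' 𝔮' h𝔮').2.1))
      -- `dim S/(𝔮 + ⋂𝓠) ≤ a` since `⋂𝓠 ⊄ 𝔮`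
      have hnle : ¬ 𝓠.inf id ≤ 𝔮 := by
        intro hle
        obtain ⟨𝔮', h𝔮', h𝔮'le⟩ := (Ideal.IsPrime.inf_le' h𝔮prime).mp hle
        haveI := (h𝓠' 𝔮' h𝔮').1
        have heq : 𝔮' = 𝔮 :=
          eq_of_le_of_ringKrullDim_quotient_eq h𝔮'le (h𝓠' 𝔮' h𝔮').2.2 h𝔮dim
        exact h𝔮𝓠 (heq ▸ h𝔮')
      have hsupdim : ringKrullDim (MvPolynomial (Fin m) K ⧸ (𝔮 ⊔ 𝓠.inf id)) ≤ a :=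
        ENat.WithBot.lt_add_one_iff.mp (ringKrullDim_quotient_sup_lt_of_not_le h𝔮dim hnle)
      have hcoeff0 : Psup.coeff a = 0 :=
        coeff_hilbertPolynomial_eq_zero_of_ringKrullDim_le
          (h𝔮hom.sup (isHomogeneous_finset_inf fun 𝔮' h𝔮' => (h𝓠' 𝔮' h𝔮').2.1)) hsupdim hPsup
      -- common `t₀`
      set T := max (max t₀ t₁) (max t₂ t₃) with hT
      have hadd := coeff_hilbertPolynomial_inf (I := 𝔮) (J := 𝓠.inf id) h𝔮hom
        (isHomogeneous_finset_inf fun 𝔮' h𝔮' => (h𝓠' 𝔮' h𝔮').2.1) (t₀ := T)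
        (fun t ht => hP𝔮 t (by omega)) (fun t ht => hPinf t (by omega))
        (fun t ht => by
          have e : (insert 𝔮 𝓠).inf id = 𝔮 ⊓ 𝓠.inf id := Finset.inf_insert
          rw [← e]; exact hP t (by omega))
        (fun t ht => hPsup t (by omega)) hcoeff0
      rw [hadd, Finset.card_insert_of_notMem h𝔮𝓠, Nat.cast_add, Nat.cast_one, add_mul, one_mul,
        add_comm]
      refine add_le_add ?_ hih
      rw [hlc𝔮]
      exact hdeg𝔮.2

end Literature.RingTheory.MvPolynomial

end
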